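import Literature.Barriers.ValiantsHypothesis.BDGIL24IsotypicNaturalProofs
import HarnessLib

/-!
# van den Berg–Dutta–Gesmundo–Ikenmeyer–Lysikov 2024, Theorem 2.2 (Nullstellensatz for the
# border class `C̄`) with Appendix A (Def. A.1, Lemma A.2) — TYPED AND PROVED

M. van den Berg, P. Dutta, F. Gesmundo, C. Ikenmeyer, V. Lysikov, *Algebraic metacomplexity and
representation theory*, arXiv:2411.03444: §2.4–2.5 and Appendix A. Companion ("EXTEND") of the
statement file `BDGIL24IsotypicNaturalProofs.lean` (val-lit row vdBDGIL24-A), whose vocabulary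
(`slice c k d r = X_{d,r}`, `vanishingIdealSeq c kk = I(C)`, `formCoeff`, `DegIdx`, `IsPBounded`)
it reuses. The paper motivates its definition of `I(C)` by this Nullstellensatz ("To emphasize how
natural this definition is, we provide a corresponding Nullstellensatz", p.10): a p-family of forms
of strictly increasing degrees lies in the border class `C̄` iff every sequence of
metapolynomials in `I(C)` eventually vanishes on it.

## Contents (source item → declaration → status)
* §2.4 "metapolynomials characterize border complexity classes" (p.9) → `metaClosure k d S` (the
  common zero set, among polynomials in `k` variables, of all format-`(∗, d, k)` metapolynomials
  vanishing on `S`), `subset_metaClosure`, `metaClosure_mono` → definitions / proved.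
* §2.4 border measure `c̲` (p.8) → `borderMeasure c k d f = min {r | f ∈ metaClosure k d X_{d,r}}`
  with `borderMeasure_le` (`c̲ ≤ c` on forms), `mem_metaClosure_slice_borderMeasure`,
  `exists_separating_of_lt_borderMeasure` → definition / proved. RENDERING (disclosed): the
  print defines `c̲(f)` by Euclidean limits `f = lim_{ε→0} f_ε`, `c(f_ε) = r`; this file takes the
  closure of `X_{d,r}` cut out by metapolynomials (its Zariski closure in `ℂ[x]_d`). The two agree
  when `X_{d,r}` is constructible — the case of the paper's measures, cf. [BLMW11, remark after
  Def. 9.3.1] — an identification NOT formalised here; and the printed proof of Thm. 2.2 uses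
  precisely the metapolynomial closure (it picks "`Δ_n` … so that `Δ_n(f_n) ≠ 0` (this is possible
  because `c̲(f_n) = r(n) = R(n) > R(n) - 1`)", p.31, i.e. a metapolynomial separating `f_n` from
  `X_{n,R(n)-1}`).
* Def. A.1 (p.30) → `IsStronglySuperpolynomial` (polynomials in the `n^c + c` currency of
  `IsPBounded`) → definition.
* Lemma A.2 (p.30) → `lemma_A_2` (`mem_vanishingIdealSeq_of_superpolynomial`,
  `exists_superpolynomial_of_mem_vanishingIdealSeq`) → PROVED ("eventually in `n`" made explicit
  on the right-hand side, as in the definition of `I(C)`; the `⇒` direction replaces the print's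
  `r(n) := max {r | Δ_n(X_{n,r}) = 0}`, which can be infinite, by an explicit finite choice).
* Thm. 2.2 (p.10; proof App. A p.30–31) → `thm_2_2` → PROVED, for ANY measure `c` (invariance is
  not used by the printed proof), `f_n` homogeneous of degree `d(n)` in `kk (d n)` variables, `d`
  strictly increasing and polynomially bounded: `IsPBounded (n ↦ c̲(f_n)) ↔ ∀ Δ ∈ I(C),
  Δ_{d(n)}(f_n) = 0 eventually`. The print's real exponents `θ(n) = log_n r(n)`, `θ̂`,
  `R(n) = ⌈n^{θ̂(n)}⌉` are replaced by the integer `logExp`/`logExpMax`/`superSeq`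
  (`R(m) = m^{θ̂(m)} + θ̂(m)`); with integers only `R(m) ≤ c̲` (not `=`) holds at the record
  times (`exists_record`), which is all the argument needs.

No new named facts (net debt 0); definitions with bodies and theorems only. Honest framing: a
2024 two-paragraph appendix formalised; nothing here bears on `VP ≠ VNP`, which is NOT proved.

## References
* [BergEtAl2024] arXiv:2411.03444, §2.4 (border complexity, p.8–9), §2.5 (`X_{d,r}`, `C`,
  `I(C)`, Thm. 2.2, p.9–10), Appendix A (Def. A.1, Lemma A.2, proof of Thm. 2.2, p.30–31); held
  text `paper:arxiv-2411.03444` p0009–p0011, p0031–p0032.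
* [BurgisserEtAl2011] P. Bürgisser, J. M. Landsberg, L. Manivel, J. Weyman, *An overview of
  mathematical issues arising in the geometric complexity theory approach to VP ≠ VNP*, SIAM J.
  Comput. 40 (2011), remark after Def. 9.3.1 (Zariski = Euclidean closure for constructible sets).

## Mathlib and tree
Mathlib: `Nat.findGreatest` (`le_findGreatest`, `findGreatest_spec`, `findGreatest_eq_iff`),
`Nat.find`, `Finset.sup`, `StrictMono.le_apply`, `MvPolynomial.rename`, `Fin.cast_refl`,
`Nat.sInf_mem`, `Nat.notMem_of_lt_sInf`. Tree: `BDGIL24IsotypicNaturalProofs` (`slice`,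
`vanishingIdealSeq`), `OrbitCoordinateRing` (`formCoeff`, `DegIdx`), `ValiantClasses`
(`IsPBounded`).
-/

noncomputable section

open MvPolynomial
open Literature.Computability.AlgebraicComplexity Literature.NumberTheory.DiophantineGeometry

namespace Literature.Barriers.ValiantsHypothesis

namespace BergEtAl2024

/-! ### The Zariski closure cut out by metapolynomials, and the border measure -/

section Border

/-- The **metapolynomial closure** of a set `S` of polynomials in `k` variables, in degree `d`:
all `f` at whose coefficient vector (`formCoeff d f`, the coefficients of the degree-`d`
monomials) every format-`(∗, d, k)` metapolynomial vanishing on `S` vanishes — the Zariski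
closure of `S` inside `ℂ[x_1,…,x_k]_d` ("metapolynomials characterize border complexity classes",
§2.4). [cite: BergEtAl2024, §2.4 (before Thm. 2.2), p.9 (PDF p.10)] -/
def metaClosure (k d : ℕ) (S : Set (MvPolynomial (Fin k) ℂ)) : Set (MvPolynomial (Fin k) ℂ) :=
  {f | ∀ Δ : MvPolynomial (DegIdx (Fin k) d) ℂ,
    (∀ g ∈ S, eval (formCoeff d g) Δ = 0) → eval (formCoeff d f) Δ = 0}

/-- Membership in the metapolynomial closure, unfolded.
[cite: BergEtAl2024, §2.4, p.9 (PDF p.10)] -/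
theorem mem_metaClosure_iff {k d : ℕ} {S : Set (MvPolynomial (Fin k) ℂ)}
    {f : MvPolynomial (Fin k) ℂ} :
    f ∈ metaClosure k d S ↔ ∀ Δ : MvPolynomial (DegIdx (Fin k) d) ℂ,
      (∀ g ∈ S, eval (formCoeff d g) Δ = 0) → eval (formCoeff d f) Δ = 0 :=
  Iff.rfl

/-- `S ⊆ \overline{S}`. [cite: BergEtAl2024, §2.4, p.9 (PDF p.10)] -/
theorem subset_metaClosure (k d : ℕ) (S : Set (MvPolynomial (Fin k) ℂ)) : S ⊆ metaClosure k d S :=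
  fun _ hf _ hΔ => hΔ _ hf

/-- The metapolynomial closure is monotone. [cite: BergEtAl2024, §2.4, p.9 (PDF p.10)] -/
theorem metaClosure_mono (k d : ℕ) {S T : Set (MvPolynomial (Fin k) ℂ)} (h : S ⊆ T) :
    metaClosure k d S ⊆ metaClosure k d T :=
  fun _ hf Δ hΔ => hf Δ fun g hg => hΔ g (h hg)

/-- The slices `X_{d,r} = {f ∈ ℂ[x]_d | c(f) ≤ r}` increase with `r`.
[cite: BergEtAl2024, §2.2 and §2.5, p.7 and p.9 (PDF p.8, p.10)] -/
theorem slice_mono (c : (k d : ℕ) → MvPolynomial (Fin k) ℂ → ℕ) (k d : ℕ) {r r' : ℕ}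
    (h : r ≤ r') : slice c k d r ⊆ slice c k d r' :=
  fun _ hf => ⟨hf.1, hf.2.trans h⟩

/-- The **border measure** `c̲` of a complexity measure `c` (§2.4: "for a given algebraic
complexity measure `c`, one can define a corresponding border measure `c̲`"), in the ZARISKI
rendering: `c̲_{k,d}(f)` is the least `r` such that `f` lies in the metapolynomial (= Zariski)
closure of the slice `X_{d,r}`. The printed `c̲` takes Euclidean limits `f = lim f_ε`,
`c(f_ε) = r`; the two closures of `X_{d,r}` agree whenever `X_{d,r}` is constructible (e.g. for
the circuit-size measures of the paper, [BLMW11, remark after Def. 9.3.1]) — an identification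
NOT formalised here; the proof of Thm. 2.2 in Appendix A separates `f_n` from `X_{n,R(n)-1}` by
a metapolynomial, i.e. it uses exactly this rendering. Junk value `0` if `f` lies in no closure
(impossible for `f` homogeneous of degree `d`, `borderMeasure_le`).
[cite: BergEtAl2024, §2.4, p.8–9 (PDF p.9–10)] -/
def borderMeasure (c : (k d : ℕ) → MvPolynomial (Fin k) ℂ → ℕ) (k d : ℕ)
    (f : MvPolynomial (Fin k) ℂ) : ℕ :=
  sInf {r | f ∈ metaClosure k d (slice c k d r)}

/-- `c̲(f) ≤ c(f)` for a form `f` of degree `d` (`f ∈ X_{d,c(f)}`).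
[cite: BergEtAl2024, §2.4, p.8–9 (PDF p.9–10)] -/
theorem borderMeasure_le (c : (k d : ℕ) → MvPolynomial (Fin k) ℂ → ℕ) {k d : ℕ}
    {f : MvPolynomial (Fin k) ℂ} (hf : f.IsHomogeneous d) : borderMeasure c k d f ≤ c k d f :=
  Nat.sInf_le (subset_metaClosure k d _ ⟨hf, le_rfl⟩)

/-- A form `f` of degree `d` lies in the closure of the slice `X_{d,c̲(f)}`.
[cite: BergEtAl2024, §2.4, p.8–9 (PDF p.9–10)] -/
theorem mem_metaClosure_slice_borderMeasure (c : (k d : ℕ) → MvPolynomial (Fin k) ℂ → ℕ)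
    {k d : ℕ} {f : MvPolynomial (Fin k) ℂ} (hf : f.IsHomogeneous d) :
    f ∈ metaClosure k d (slice c k d (borderMeasure c k d f)) :=
  Nat.sInf_mem (⟨c k d f, subset_metaClosure k d _ ⟨hf, le_rfl⟩⟩ :
    {r | f ∈ metaClosure k d (slice c k d r)}.Nonempty)

/-- Below `c̲(f)` the form `f` is NOT in the closure of the slice: for `r < c̲(f)` some
metapolynomial vanishes on `X_{d,r}` but not at `f`.
[cite: BergEtAl2024, §2.4 and App. A (proof of Thm. 2.2), p.9 and p.31 (PDF p.10, p.32)] -/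
theorem exists_separating_of_lt_borderMeasure (c : (k d : ℕ) → MvPolynomial (Fin k) ℂ → ℕ)
    {k d r : ℕ} {f : MvPolynomial (Fin k) ℂ} (h : r < borderMeasure c k d f) :
    ∃ Δ : MvPolynomial (DegIdx (Fin k) d) ℂ,
      (∀ g ∈ slice c k d r, eval (formCoeff d g) Δ = 0) ∧ eval (formCoeff d f) Δ ≠ 0 := by
  have hnot : f ∉ metaClosure k d (slice c k d r) := Nat.notMem_of_lt_sInf h
  simp only [mem_metaClosure_iff, not_forall, exists_prop] at hnot
  exact hnot

end Border

/-! ### Appendix A: strongly superpolynomial sequences and Lemma A.2 -/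

section AppendixA

/-- **Definition A.1**: a sequence `r : ℕ → ℕ` is *strongly superpolynomial* if it eventually
dominates every polynomial sequence: "for every polynomial `p` there exists `N` such that
`r(n) > p(n)` for all `n ≥ N`" (polynomials in the tree's `n^c + c` currency of `IsPBounded`).
[cite: BergEtAl2024, Def. A.1, p.30 (PDF p.31)] -/
def IsStronglySuperpolynomial (r : ℕ → ℕ) : Prop :=
  ∀ c : ℕ, ∃ N : ℕ, ∀ n, N ≤ n → n ^ c + c < r n

/-- A strongly superpolynomial sequence eventually exceeds every p-bounded one (strictly).
[cite: BergEtAl2024, Lemma A.2 (proof), p.30 (PDF p.31)] -/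
theorem IsStronglySuperpolynomial.eventually_lt {R p : ℕ → ℕ} (hR : IsStronglySuperpolynomial R)
    (hp : IsPBounded p) : ∃ N, ∀ n, N ≤ n → p n < R n := by
  obtain ⟨c, hc⟩ := hp
  obtain ⟨N, hN⟩ := hR c
  exact ⟨N, fun n hn => (hc n).trans_lt (hN n hn)⟩

/-- **Lemma A.2, `⇐`**: if, from some index on, `Δ_n` vanishes on `X_{n,R(n)-1}` for a strongly
superpolynomial `R`, then `(Δ_n) ∈ I(C)` ("clearly, … `Δ_n(X_{n,p(n)})` vanishes eventually for
every polynomially bounded sequence `p`, since `p(n) ≤ r(n)` eventually").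
[cite: BergEtAl2024, Lemma A.2, p.30 (PDF p.31)] -/
theorem mem_vanishingIdealSeq_of_superpolynomial (c : (k d : ℕ) → MvPolynomial (Fin k) ℂ → ℕ)
    (kk : ℕ → ℕ) {R : ℕ → ℕ} (hR : IsStronglySuperpolynomial R)
    {Δ : (n : ℕ) → MvPolynomial (DegIdx (Fin (kk n)) n) ℂ} (n₁ : ℕ)
    (hΔ : ∀ n, n₁ ≤ n → ∀ g ∈ slice c (kk n) n (R n - 1), eval (formCoeff n g) (Δ n) = 0) :
    Δ ∈ vanishingIdealSeq c kk := by
  intro p hp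
  obtain ⟨N, hN⟩ := hR.eventually_lt hp
  refine ⟨max N n₁, fun n hn g hg =>
    hΔ n ((le_max_right _ _).trans hn) g (slice_mono c (kk n) n ?_ hg)⟩
  have := hN n ((le_max_left _ _).trans hn)
  omega

/-- **Lemma A.2, `⇒`**: if `(Δ_n) ∈ I(C)` then, from some index on, `Δ_n` vanishes on
`X_{n,R(n)}` for a strongly superpolynomial `R` (the print's `r(n) := max {r | Δ_n(X_{n,r}) = 0}`;
here `R(n) = n^{e(n)} + e(n)` with `e(n)` the largest `e ≤ n` such that the vanishing thresholds
of the polynomials `m^{e'} + e'`, `e' ≤ e`, are all `≤ n` — which avoids the case where the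
printed maximum is infinite). [cite: BergEtAl2024, Lemma A.2, p.30 (PDF p.31)] -/
theorem exists_superpolynomial_of_mem_vanishingIdealSeq
    (c : (k d : ℕ) → MvPolynomial (Fin k) ℂ → ℕ) (kk : ℕ → ℕ)
    {Δ : (n : ℕ) → MvPolynomial (DegIdx (Fin (kk n)) n) ℂ} (hΔ : Δ ∈ vanishingIdealSeq c kk) :
    ∃ R : ℕ → ℕ, IsStronglySuperpolynomial R ∧ ∃ n₁, ∀ n, n₁ ≤ n →
      ∀ g ∈ slice c (kk n) n (R n), eval (formCoeff n g) (Δ n) = 0 := by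
  classical
  have hN : ∀ e : ℕ, ∃ N, ∀ n, N ≤ n →
      ∀ g ∈ slice c (kk n) n (n ^ e + e), eval (formCoeff n g) (Δ n) = 0 :=
    fun e => hΔ (fun n => n ^ e + e) ⟨e, fun n => le_rfl⟩
  choose N hN using hN
  set ex : ℕ → ℕ := fun n => Nat.findGreatest (fun e => ∀ e', e' ≤ e → N e' ≤ n) n with hex
  refine ⟨fun n => n ^ ex n + ex n, ?_, N 0, fun n hn g hg => ?_⟩
  · intro k
    refine ⟨max (k + 1) ((Finset.range (k + 2)).sup N), fun n hn => ?_⟩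
    have hk1 : k + 1 ≤ n := (le_max_left _ _).trans hn
    have hall : ∀ e', e' ≤ k + 1 → N e' ≤ n := fun e' he' =>
      (Finset.le_sup (f := N) (Finset.mem_range.mpr (by omega))).trans ((le_max_right _ _).trans hn)
    have hexk : k + 1 ≤ ex n :=
      Nat.le_findGreatest (P := fun e => ∀ e', e' ≤ e → N e' ≤ n) hk1 hall
    have hn1 : 1 ≤ n := by omega
    have hpow : n ^ k ≤ n ^ ex n := Nat.pow_le_pow_right hn1 (by omega)
    show n ^ k + k < n ^ ex n + ex n
    omega
  · have hP : ∀ e', e' ≤ ex n → N e' ≤ n := by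
      have h0 : ∀ e', e' ≤ 0 → N e' ≤ n := fun e' he' => by rw [Nat.le_zero.mp he']; exact hn
      exact Nat.findGreatest_spec (P := fun e => ∀ e', e' ≤ e → N e' ≤ n) (Nat.zero_le n) h0
    exact hN (ex n) n (hP (ex n) le_rfl) g hg

/-- **Lemma A.2.** "`(Δ_n) ∈ I(C)` if and only if there exists a strongly superpolynomial
sequence `r` such that `Δ_n(X_{n,r(n)}) = 0`" (eventually in `n`, as in the definition of `I(C)`).
[cite: BergEtAl2024, Lemma A.2, p.30 (PDF p.31)] -/
theorem lemma_A_2 (c : (k d : ℕ) → MvPolynomial (Fin k) ℂ → ℕ) (kk : ℕ → ℕ)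
    (Δ : (n : ℕ) → MvPolynomial (DegIdx (Fin (kk n)) n) ℂ) :
    Δ ∈ vanishingIdealSeq c kk ↔ ∃ R : ℕ → ℕ, IsStronglySuperpolynomial R ∧ ∃ n₁, ∀ n, n₁ ≤ n →
      ∀ g ∈ slice c (kk n) n (R n), eval (formCoeff n g) (Δ n) = 0 := by
  refine ⟨exists_superpolynomial_of_mem_vanishingIdealSeq c kk, ?_⟩
  rintro ⟨R, hR, n₁, hn₁⟩
  exact mem_vanishingIdealSeq_of_superpolynomial c kk hR n₁ fun n hn g hg =>
    hn₁ n hn g (slice_mono c (kk n) n (Nat.sub_le _ _) hg)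

/-- Composition of p-bounds: `(n^b + b)^a + a ≤ n^e + e` for a constant `e = e(a, b)`.
[cite: BergEtAl2024, App. A (proof of Thm. 2.2: "(f'_n) is a p-family as well"), p.30 (PDF p.31)] -/
theorem exists_pbound_comp (a b : ℕ) : ∃ e : ℕ, ∀ n : ℕ, (n ^ b + b) ^ a + a ≤ n ^ e + e := by
  refine ⟨a * (b + 1) + (b + 1) ^ a + a, fun n => ?_⟩
  rcases Nat.lt_or_ge n 2 with hn | hn
  · interval_cases n
    · have h0 : (0 : ℕ) ^ b + b ≤ b + 1 := by
        rcases Nat.eq_zero_or_pos b with rfl | hb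
        · simp
        · rw [zero_pow hb.ne']; omega
      calc ((0 : ℕ) ^ b + b) ^ a + a ≤ (b + 1) ^ a + a := by gcongr
        _ ≤ (0 : ℕ) ^ (a * (b + 1) + (b + 1) ^ a + a) + (a * (b + 1) + (b + 1) ^ a + a) :=
          le_add_left (by omega)
    · simp only [one_pow]
      rw [add_comm 1 b]
      omega
  · have h1 : b ≤ n ^ b := (Nat.lt_pow_self (by omega : 1 < n)).le
    have h2 : n ^ b + b ≤ n ^ (b + 1) := by rw [pow_succ]; nlinarith
    have h3 : (n ^ b + b) ^ a ≤ n ^ (a * (b + 1)) := by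
      calc (n ^ b + b) ^ a ≤ (n ^ (b + 1)) ^ a := Nat.pow_le_pow_left h2 a
        _ = n ^ (a * (b + 1)) := by rw [← pow_mul, mul_comm]
    have h4 : n ^ (a * (b + 1)) ≤ n ^ (a * (b + 1) + (b + 1) ^ a + a) :=
      Nat.pow_le_pow_right (by omega) (by omega)
    omega

/-! #### The sequence `R(n)` of the proof of Thm. 2.2 (integer version of `θ, θ̂, R`) -/

variable (ρ : ℕ → ℕ)

/-- `θ(m)`: the largest exponent `e ≤ ρ(m)` with `m^e + e ≤ ρ(m)` (the print's
`θ(n) = log_n r(n)`, kept integral).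
[cite: BergEtAl2024, App. A (proof of Thm. 2.2), p.30 (PDF p.31)] -/
def logExp (m : ℕ) : ℕ := Nat.findGreatest (fun e => m ^ e + e ≤ ρ m) (ρ m)

/-- `θ̂(m) = max {θ(j) | j ≤ m}`.
[cite: BergEtAl2024, App. A (proof of Thm. 2.2), p.30 (PDF p.31)] -/
def logExpMax (m : ℕ) : ℕ := (Finset.range (m + 1)).sup (logExp ρ)

/-- `R(m) = m^{θ̂(m)} + θ̂(m)` (the print's `⌈n^{θ̂(n)}⌉`, in the `n^c + c` currency).
[cite: BergEtAl2024, App. A (proof of Thm. 2.2), p.30 (PDF p.31)] -/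
def superSeq (m : ℕ) : ℕ := m ^ logExpMax ρ m + logExpMax ρ m

/-- `θ(j) ≤ θ̂(m)` for `j ≤ m`. [cite: BergEtAl2024, App. A (proof of Thm. 2.2), p.30 (PDF p.31)] -/
theorem logExp_le_logExpMax {j m : ℕ} (h : j ≤ m) : logExp ρ j ≤ logExpMax ρ m :=
  Finset.le_sup (f := logExp ρ) (Finset.mem_range.mpr (Nat.lt_succ_of_le h))

/-- `θ̂` is monotone ("`R(n)` is monotonically increasing").
[cite: BergEtAl2024, App. A (proof of Thm. 2.2), p.30 (PDF p.31)] -/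
theorem logExpMax_mono : Monotone (logExpMax ρ) := fun _ _ h =>
  Finset.sup_mono (Finset.range_mono (Nat.succ_le_succ h))

/-- Any admissible exponent is at most `θ(m)`.
[cite: BergEtAl2024, App. A (proof of Thm. 2.2), p.30 (PDF p.31)] -/
theorem le_logExp_of_le {m e : ℕ} (h : m ^ e + e ≤ ρ m) : e ≤ logExp ρ m :=
  Nat.le_findGreatest ((Nat.le_add_left e (m ^ e)).trans h) h

/-- If `θ(m) ≠ 0` then `m^{θ(m)} + θ(m) ≤ ρ(m)`.
[cite: BergEtAl2024, App. A (proof of Thm. 2.2), p.30 (PDF p.31)] -/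
theorem pow_logExp_add_logExp_le {m : ℕ} (h : logExp ρ m ≠ 0) : m ^ logExp ρ m + logExp ρ m ≤ ρ m :=
  ((Nat.findGreatest_eq_iff.mp (rfl : logExp ρ m = logExp ρ m)).2.1) h

/-- "The sequence `R(n)` is strongly superpolynomial" when `ρ` is not polynomially bounded: for
every `k` some `θ(n₀) ≥ k`, hence `θ̂(n) ≥ k` for all `n ≥ n₀`.
[cite: BergEtAl2024, App. A (proof of Thm. 2.2), p.30 (PDF p.31)] -/
theorem superSeq_superpolynomial (hρ : ¬ IsPBounded ρ) :
    IsStronglySuperpolynomial (superSeq ρ) := by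
  intro c
  have hex : ∃ m₀, m₀ ^ (c + 1) + (c + 1) < ρ m₀ := by
    by_contra hcon
    push Not at hcon
    exact hρ ⟨c + 1, hcon⟩
  obtain ⟨m₀, hm₀⟩ := hex
  have hθ : c + 1 ≤ logExp ρ m₀ := le_logExp_of_le ρ hm₀.le
  refine ⟨max m₀ 1, fun n hn => ?_⟩
  have hE : c + 1 ≤ logExpMax ρ n := hθ.trans (logExp_le_logExpMax ρ ((le_max_left _ _).trans hn))
  have hn1 : 1 ≤ n := (le_max_right _ _).trans hn
  have hpow : n ^ c ≤ n ^ logExpMax ρ n := Nat.pow_le_pow_right hn1 (by omega)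
  unfold superSeq
  omega

/-- **Record times**: if `ρ` is not polynomially bounded then beyond every `M` there is an `m`
with `1 ≤ R(m) ≤ ρ(m)` (the print: "`θ` and `θ̂` coincide on an infinite subset of `ℕ`; on this
subset `R(n) = r(n)`" — with integer exponents only `R ≤ ρ` survives, which is all the proof
needs). [cite: BergEtAl2024, App. A (proof of Thm. 2.2), p.30–31 (PDF p.31–32)] -/
theorem exists_record (hρ : ¬ IsPBounded ρ) (M : ℕ) :
    ∃ m, M < m ∧ 1 ≤ superSeq ρ m ∧ superSeq ρ m ≤ ρ m := by
  classical
  set e₀ := logExpMax ρ M + 1 with he₀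
  have hex : ∃ m, e₀ ≤ logExp ρ m := by
    have : ∃ m, m ^ e₀ + e₀ < ρ m := by
      by_contra hcon
      push Not at hcon
      exact hρ ⟨e₀, hcon⟩
    obtain ⟨m, hm⟩ := this
    exact ⟨m, le_logExp_of_le ρ hm.le⟩
  set m := Nat.find hex with hm
  have hQ : e₀ ≤ logExp ρ m := Nat.find_spec hex
  have hMm : M < m := by
    by_contra hle
    push Not at hle
    have := logExp_le_logExpMax ρ hle
    omega
  have hmax : logExpMax ρ m = logExp ρ m := by
    refine le_antisymm (Finset.sup_le fun j hj => ?_) (logExp_le_logExpMax ρ le_rfl)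
    rcases (Nat.lt_succ_iff.mp (Finset.mem_range.mp hj)).lt_or_eq with hlt | rfl
    · have hnot : ¬ e₀ ≤ logExp ρ j := Nat.find_min hex (by rwa [hm] at hlt)
      omega
    · exact le_rfl
  have hθ0 : logExp ρ m ≠ 0 := by omega
  have hP := pow_logExp_add_logExp_le ρ hθ0
  refine ⟨m, hMm, ?_, ?_⟩
  · unfold superSeq; omega
  · unfold superSeq; rw [hmax]; exact hP

end AppendixA

/-! ### Theorem 2.2 (Nullstellensatz for `C̄`) -/

section Nullstellensatz

/-- **van den Berg–Dutta–Gesmundo–Ikenmeyer–Lysikov 2024, Theorem 2.2 (Nullstellensatz for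
`C̄`).** "Let `(f_n)_{n ∈ ℕ}` be a p-family of homogeneous polynomials such that `(deg f_n)` is a
strictly increasing sequence. The sequence `(f_n)` lies in `C̄` if and only if for every
`(Δ_n) ∈ I(C)` we have `Δ_{deg(f_n)}(f_n) = 0` eventually." Typed with: `f_n` homogeneous of
degree `d(n)` in `k(d(n))` variables (`k = kk` the format's variable count, as in
`vanishingIdealSeq c kk`), `d` strictly increasing and polynomially bounded (the p-family
condition on degrees; the one on the number of variables is not needed and not assumed),
"`(f_n) ∈ C̄`" = "`c̲(f_n)` is polynomially bounded" with `c̲ = borderMeasure c` (the Zariski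
rendering of §2.4's border measure, see `borderMeasure`), `I(C) = vanishingIdealSeq c kk`.
Invariance of `c` is not used by the printed proof and not assumed (stronger). Proof = Appendix A:
(⇒) `f_n ∈ \overline{X_{d(n), c̲(f_n)}} ⊆ \overline{X_{d(n), p(d(n))}}` and `Δ_m` kills
`X_{m,p(m)}` eventually, hence its closure; (⇐) if `c̲(f_n)` is not polynomially bounded, the
strongly superpolynomial `R` (`superSeq`) has `1 ≤ R(m) ≤ c̲(f_n)` at infinitely many degrees
`m = d(n)` (`exists_record`); there pick `Δ_m` vanishing on `X_{m,R(m)-1}` with `Δ_m(f_n) ≠ 0`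
(`exists_separating_of_lt_borderMeasure`), elsewhere `Δ_m = 0`; `(Δ_m) ∈ I(C)` by Lemma A.2.
[cite: BergEtAl2024, Thm. 2.2, p.10 (PDF p.11); proof App. A, p.30–31 (PDF p.31–32)] -/
theorem thm_2_2 (c : (k d : ℕ) → MvPolynomial (Fin k) ℂ → ℕ) (kk d : ℕ → ℕ) (hd : StrictMono d)
    (hdp : IsPBounded d) (f : (n : ℕ) → MvPolynomial (Fin (kk (d n))) ℂ)
    (hf : ∀ n, (f n).IsHomogeneous (d n)) :
    IsPBounded (fun n => borderMeasure c (kk (d n)) (d n) (f n)) ↔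
      ∀ Δ ∈ vanishingIdealSeq c kk,
        ∃ n₀, ∀ n, n₀ ≤ n → eval (formCoeff (d n) (f n)) (Δ (d n)) = 0 := by
  classical
  constructor
  · rintro ⟨a, ha⟩ Δ hΔ
    obtain ⟨N, hN⟩ := hΔ (fun m => m ^ a + a) ⟨a, fun m => le_rfl⟩
    refine ⟨N, fun n hn => ?_⟩
    have hnd : n ≤ d n := hd.le_apply
    have hle : borderMeasure c (kk (d n)) (d n) (f n) ≤ d n ^ a + a :=
      (ha n).trans (Nat.add_le_add_right (Nat.pow_le_pow_left hnd a) a)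
    have hmem : f n ∈ metaClosure (kk (d n)) (d n) (slice c (kk (d n)) (d n) (d n ^ a + a)) :=
      metaClosure_mono _ _ (slice_mono c _ _ hle) (mem_metaClosure_slice_borderMeasure c (hf n))
    exact hmem (Δ (d n)) (hN (d n) (hn.trans hnd))
  · intro h
    by_contra hnb
    -- Step 0 ("we may assume `deg f_n = n`"): re-index the family by the degree.
    have hkey : ∀ (n' m' : ℕ) (h' : d n' = m'),
        (rename (Fin.cast (congrArg kk h')) (f n')).IsHomogeneous m' := by
      intro n' m' h'
      subst h'
      simpa using hf n'
    set g : (m : ℕ) → MvPolynomial (Fin (kk m)) ℂ := fun m =>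
      if hm : ∃ n, d n = m then rename (Fin.cast (congrArg kk hm.choose_spec)) (f hm.choose) else 0
      with hgdef
    have hg : ∀ n, g (d n) = f n := by
      intro n
      have hex : ∃ n', d n' = d n := ⟨n, rfl⟩
      have hn' : hex.choose = n := hd.injective hex.choose_spec
      have key : ∀ (n' : ℕ) (h' : d n' = d n),
          rename (Fin.cast (congrArg kk h')) (f n') = f n := by
        intro n' h'
        obtain rfl : n' = n := hd.injective h'
        simp
      simp only [hgdef, dif_pos hex]
      exact key _ hex.choose_spec
    have hghom : ∀ m, (g m).IsHomogeneous m := by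
      intro m
      by_cases hm : ∃ n, d n = m
      · simp only [hgdef, dif_pos hm]
        exact hkey hm.choose m hm.choose_spec
      · simp only [hgdef, dif_neg hm]
        exact isHomogeneous_zero _ _ _
    -- the degree-indexed border complexities `ρ(m) = c̲(f_n)` for `m = d(n)`, else `0`
    set ρ : ℕ → ℕ := fun m => if ∃ n, d n = m then borderMeasure c (kk m) m (g m) else 0 with hρdef
    have hρ : ∀ n, ρ (d n) = borderMeasure c (kk (d n)) (d n) (f n) := by
      intro n
      simp only [hρdef, if_pos (⟨n, rfl⟩ : ∃ n', d n' = d n), hg n]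
    have hρnb : ¬ IsPBounded ρ := by
      rintro ⟨a, ha⟩
      obtain ⟨b, hb⟩ := hdp
      obtain ⟨e, he⟩ := exists_pbound_comp a b
      refine hnb ⟨e, fun n => ?_⟩
      calc borderMeasure c (kk (d n)) (d n) (f n) = ρ (d n) := (hρ n).symm
        _ ≤ d n ^ a + a := ha (d n)
        _ ≤ (n ^ b + b) ^ a + a := Nat.add_le_add_right (Nat.pow_le_pow_left (hb n) a) a
        _ ≤ n ^ e + e := he n
    -- the strongly superpolynomial sequence `R` and the equations `Δ_m`
    have hRsp : IsStronglySuperpolynomial (superSeq ρ) := superSeq_superpolynomial ρ hρnb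
    have hsep : ∀ m, 1 ≤ superSeq ρ m ∧ superSeq ρ m ≤ ρ m →
        ∃ Δ : MvPolynomial (DegIdx (Fin (kk m)) m) ℂ,
          (∀ g' ∈ slice c (kk m) m (superSeq ρ m - 1), eval (formCoeff m g') Δ = 0) ∧
            eval (formCoeff m (g m)) Δ ≠ 0 := by
      rintro m ⟨h1, h2⟩
      have hm : ∃ n, d n = m := by
        by_contra hm
        have hρ0 : ρ m = 0 := by simp only [hρdef, if_neg hm]
        omega
      have hρm : ρ m = borderMeasure c (kk m) m (g m) := by simp only [hρdef, if_pos hm]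
      exact exists_separating_of_lt_borderMeasure c (by rw [← hρm]; omega)
    set Δ : (m : ℕ) → MvPolynomial (DegIdx (Fin (kk m)) m) ℂ := fun m =>
      if hm : 1 ≤ superSeq ρ m ∧ superSeq ρ m ≤ ρ m then (hsep m hm).choose else 0 with hΔdef
    have hΔI : Δ ∈ vanishingIdealSeq c kk := by
      refine mem_vanishingIdealSeq_of_superpolynomial c kk hRsp 0 fun m _ g' hg' => ?_
      by_cases hm : 1 ≤ superSeq ρ m ∧ superSeq ρ m ≤ ρ m
      · simp only [hΔdef, dif_pos hm]
        exact (hsep m hm).choose_spec.1 g' hg'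
      · simp only [hΔdef, dif_neg hm]
        exact map_zero _
    obtain ⟨n₀, hn₀⟩ := h Δ hΔI
    obtain ⟨m, hMm, h1, h2⟩ := exists_record ρ hρnb (d n₀)
    have hm : ∃ n, d n = m := by
      by_contra hm
      have hρ0 : ρ m = 0 := by simp only [hρdef, if_neg hm]
      omega
    obtain ⟨n, rfl⟩ := hm
    have hn : n₀ ≤ n := (hd.lt_iff_lt.mp hMm).le
    have hne : eval (formCoeff (d n) (g (d n))) (Δ (d n)) ≠ 0 := by
      simp only [hΔdef,
        dif_pos (show 1 ≤ superSeq ρ (d n) ∧ superSeq ρ (d n) ≤ ρ (d n) from ⟨h1, h2⟩)]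
      exact (hsep (d n) ⟨h1, h2⟩).choose_spec.2
    rw [hg n] at hne
    exact hne (hn₀ n hn)

end Nullstellensatz

end BergEtAl2024

end Literature.Barriers.ValiantsHypothesis

end
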